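import Literature.Probability.Percolation.OneArmOSSSBox
import HarnessLib

/-!
# The OSSS one-arm differential inequality on `ℤ^d`: `θ_n' ≥ n·θ_n(1 − θ_n) / (4p(1−p)·S_n)`

Source: H. Duminil-Copin, A. Raoufi, V. Tassion, *Sharp phase transition for the random-cluster and Potts
models via decision trees*, Ann. of Math. 189 (2019), §3: Lemma 3.2 and eqs. (3.2)–(3.4) of the proof of
Thm 1.2 ("`∑_e Cov(𝟙_{0↔∂Λ_n}, ω_e) ≥ n/(8S_n)·θ_n(1−θ_n)` … `θ_n' ≥ c (n/S_n) θ_n`"), in the case `q = 1` of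
Bernoulli bond percolation on `ℤ^d`, where the finite-volume measure is the product measure itself and the
constant is the one of H. Duminil-Copin, *Sharp threshold phenomena in statistical physics*
(arXiv:1810.03384), Lemma 3.8 and the display following it:

  `θ_n'(p) = ∑_{e∈E_n} P_p(e pivotal) ≥ n/(4p(1−p)S_n) · θ_n(1−θ_n)`,  `S_n = ∑_{k=0}^{n−1} θ_k`,

`θ_k(p) = P_p(0 ↔ ∂Λ_k)`.  This is the decision-tree (OSSS) form of Menshikov's differential inequality
(Grimmett 1999, (5.22)).  Assembly: the one-seed-set variance inequality
`SeedExploration.variance_le_sum_revealment_mul_piv` (`OneArmOSSSCovariance.lean`) for each sphere `∂Λ_k`,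
`1 ≤ k ≤ n` (`OneArmOSSSBox.lean`), summed over `k`; the revealment sums are bounded by
`∑_{k=1}^n θ_{|k−‖u‖|} ≤ 2S_n` (`sum_Icc_dist_le`); Russo's formula (`russo_formula_sum_holds`) identifies
`∑_e P_p(e pivotal)` with `θ_n'`.

* `sum_Icc_dist_le` — `∑_{k=1}^{n} f(|k − s|) ≤ 2 ∑_{j<n} f(j)` for antitone `f ≥ 0`, `s ≤ n`;
* `oneArm_variance_le` — `n·θ_n(1−θ_n) ≤ 4·S_n·p(1−p)·∑_{e ⊆ Λ_n} P_p(e ∈ E(ℤ^d) pivotal for {0↔∂Λ_n})`;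
* `oneArm_hasDerivAt_ge` / `oneArm_deriv_ge` — **`n·θ_n(p)(1−θ_n(p)) ≤ 4p(1−p)·S_n(p)·θ_n'(p)`** for
  `p ∈ (0,1)`, every `d ≥ 1`, `n ≥ 0`, with `θ_n = DCT16.thetaN d n`.
-/

noncomputable section

namespace Literature.Probability.Percolation

open _root_.MeasureTheory Finset Function Literature.Probability.LatticeModels
open Literature.Probability.ODonnellSaksSchrammServedio2005
open GhostExploration SeedExploration DCT16

namespace OneArmOSSS

variable {d : ℕ}

/-! ### The averaged revealment: `∑_{k=1}^{n} θ_{|k − s|} ≤ 2 S_n` -/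

/-- For an antitone `f ≥ 0` and `s ≤ n`: `∑_{k=1}^{n} f(|k − s|) ≤ 2·∑_{j<n} f(j)` (the values `|k − s|`,
`k ≤ s`, run through `0,…,s−1`; for `k > s` through `1,…,n−s`, and `f(j) ≤ f(j−1)`).
[cite: DuminilCopinRaoufiTassion2019, §3 proof of Lemma 3.2 (∑_{k=1}^n μ[u ↔ ∂Λ_{|k−d(u,0)|}(u)] ≤ 2 S_n)] -/
theorem sum_Icc_dist_le (f : ℕ → ℝ) (hf : Antitone f) (hf0 : ∀ j, 0 ≤ f j) {s n : ℕ} (hs : s ≤ n) :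
    ∑ k ∈ Finset.Icc 1 n, f (Nat.dist k s) ≤ 2 * ∑ j ∈ Finset.range n, f j := by
  have hIcc : Finset.Icc 1 n = Finset.Ico 1 (n + 1) := by
    ext k; simp only [Finset.mem_Icc, Finset.mem_Ico]; omega
  rw [hIcc, ← Finset.sum_Ico_consecutive _ (show 1 ≤ s + 1 by omega) (show s + 1 ≤ n + 1 by omega)]
  -- part A: `k ≤ s`
  have hA : ∑ k ∈ Finset.Ico 1 (s + 1), f (Nat.dist k s) ≤ ∑ j ∈ Finset.range n, f j := by
    have h1 : ∑ k ∈ Finset.Ico 1 (s + 1), f (Nat.dist k s) = ∑ k ∈ Finset.Ico 1 (s + 1), f (s - k) := by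
      refine Finset.sum_congr rfl fun k hk => ?_
      rw [Finset.mem_Ico] at hk
      rw [Nat.dist_eq_sub_of_le (by omega)]
    rw [h1, Finset.sum_Ico_reflect f 1 (le_refl (s + 1))]
    have h2 : Finset.Ico (s + 1 - (s + 1)) (s + 1 - 1) = Finset.range s := by
      ext j; simp only [Finset.mem_Ico, Finset.mem_range]; omega
    rw [h2]
    exact Finset.sum_le_sum_of_subset_of_nonneg (Finset.range_subset_range.2 hs) fun j _ _ => hf0 j
  -- part B: `k > s`
  have hB : ∑ k ∈ Finset.Ico (s + 1) (n + 1), f (Nat.dist k s) ≤ ∑ j ∈ Finset.range n, f j := by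
    rw [Finset.sum_Ico_eq_sum_range]
    have h1 : ∑ j ∈ Finset.range (n + 1 - (s + 1)), f (Nat.dist (s + 1 + j) s)
        = ∑ j ∈ Finset.range (n - s), f (j + 1) := by
      have : n + 1 - (s + 1) = n - s := by omega
      rw [this]
      refine Finset.sum_congr rfl fun j _ => ?_
      rw [Nat.dist_eq_sub_of_le_right (by omega)]
      congr 1; omega
    rw [h1]
    calc ∑ j ∈ Finset.range (n - s), f (j + 1) ≤ ∑ j ∈ Finset.range (n - s), f j :=
          Finset.sum_le_sum fun j _ => hf (Nat.le_succ j)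
      _ ≤ ∑ j ∈ Finset.range n, f j :=
          Finset.sum_le_sum_of_subset_of_nonneg (Finset.range_subset_range.2 (Nat.sub_le n s))
            fun j _ _ => hf0 j
  linarith

/-! ### The one-arm variance inequality on `ℤ^d` -/

/-- `θ_j(p) = P_p(0 ↔ ∂Λ_j)` as a function of `j` is antitone and nonnegative (plumbing for the sums).
[cite: DuminilCopinTassionEM2016, §2.1 (P_p[0 ⟷ ∂Λ_n] ≤ P_p[0 ⟷ ∂Λ_m] for m ≤ n)] -/
theorem antitone_real_siteToBoundary (p : unitInterval) :
    Antitone fun j => (bondPercolation (zdGraph d) p).real (siteToBoundary d j) :=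
  fun _ _ hmn => real_siteToBoundary_antitone p hmn

/-- THE REVEALMENT SUM: for `a, b ∈ Λ_n`,
`∑_{k=1}^n (θ_{|k−‖a‖|} + θ_{|k−‖b‖|}) ≤ 4 S_n`, `S_n = ∑_{j<n} θ_j`.
[cite: DuminilCopinRaoufiTassion2019, §3 proof of Lemma 3.2 (∑_k δ_e(T_k) ≤ 4 max_x ∑_k μ[x ↔ ∂Λ_k(x)])] -/
theorem sum_Icc_revealment_le (n : ℕ) (p : unitInterval) {a b : Site d} (ha : a ∈ box d n) (hb : b ∈ box d n) :
    ∑ k ∈ Finset.Icc 1 n,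
        ((bondPercolation (zdGraph d) p).real (siteToBoundary d (Nat.dist k (boxNorm a)))
          + (bondPercolation (zdGraph d) p).real (siteToBoundary d (Nat.dist k (boxNorm b))))
      ≤ 4 * ∑ j ∈ Finset.range n, (bondPercolation (zdGraph d) p).real (siteToBoundary d j) := by
  rw [Finset.sum_add_distrib]
  have hA := sum_Icc_dist_le _ (antitone_real_siteToBoundary (d := d) p) (fun _ => measureReal_nonneg)
    (mem_box_iff_boxNorm_le.1 ha)
  have hB := sum_Icc_dist_le _ (antitone_real_siteToBoundary (d := d) p) (fun _ => measureReal_nonneg)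
    (mem_box_iff_boxNorm_le.1 hb)
  linarith

/-- The revealment majorant of the sphere `∂Λ_k` for the pair `e`: `θ_{|k−‖a‖|} + θ_{|k−‖b‖|}` for `e = {a,b}`.
[cite: DuminilCopinRaoufiTassion2019, §3 proof of Lemma 3.2 (δ_e(T) ≤ μ[u↔∂Λ_k] + μ[v↔∂Λ_k])] -/
def revMaj (n : ℕ) (p : unitInterval) (k : ℕ) (e : PairIdx d n) : ℝ :=
  Sym2.lift ⟨fun a b : Site d =>
    (bondPercolation (zdGraph d) p).real (siteToBoundary d (Nat.dist k (boxNorm a)))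
      + (bondPercolation (zdGraph d) p).real (siteToBoundary d (Nat.dist k (boxNorm b))),
    fun _ _ => add_comm _ _⟩ e.1

/-- The revealment majorant is nonnegative. [cite: DuminilCopinRaoufiTassion2019, §3 proof of Lemma 3.2 (δ_e ≥ 0)] -/
theorem revMaj_nonneg (n : ℕ) (p : unitInterval) (k : ℕ) (e : PairIdx d n) : 0 ≤ revMaj n p k e := by
  unfold revMaj
  induction' e using Subtype.rec with z hz
  induction z using Sym2.ind with
  | h _ _ => simp only [Sym2.lift_mk]; exact add_nonneg measureReal_nonneg measureReal_nonneg

/-- The summed revealment majorant is at most `4 S_n`. [cite: DuminilCopinRaoufiTassion2019, §3 proof of Lemma 3.2 (summing over k, ≤ 4 max ∑ ≤ … S_n)] -/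
theorem sum_revMaj_le (n : ℕ) (p : unitInterval) (e : PairIdx d n) :
    ∑ k ∈ Finset.Icc 1 n, revMaj n p k e
      ≤ 4 * ∑ j ∈ Finset.range n, (bondPercolation (zdGraph d) p).real (siteToBoundary d j) := by
  obtain ⟨z, hz⟩ := e
  unfold revMaj
  induction z using Sym2.ind with
  | h a b =>
    simp only [Sym2.lift_mk]
    have hab := Finset.mk_mem_sym2_iff.1 hz
    exact sum_Icc_revealment_le n p hab.1 hab.2

/-- ONE SPHERE: for `1 ≤ k ≤ n` (and `d ≥ 1`), with `θ = P_p(0 ↔ ∂Λ_n)`,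
`θ − θ² ≤ ∑_e (θ_{|k−‖a_e‖|} + θ_{|k−‖b_e‖|}) · b_e(1−b_e) · Piv_e` on the box cube (biases `b_e = p` on lattice
edges, `0` elsewhere). [cite: DuminilCopinRaoufiTassion2019, §3 Lemma 3.2 (OSSS for the tree of ∂Λ_k)] -/
theorem variance_le_sphere (hd : 1 ≤ d) (n : ℕ) (p : unitInterval) {k : ℕ} (hk1 : 1 ≤ k) (hkn : k ≤ n) :
    (bondPercolation (zdGraph d) p).real (siteToBoundary d n)
        - ((bondPercolation (zdGraph d) p).real (siteToBoundary d n)) ^ 2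
      ≤ ∑ e : PairIdx d n, revMaj n p k e * (boxBias d n p e * (1 - boxBias d n p e))
          * pivArm (latEdge d n) (boxBias d n p) (origin d n) (bdryTarget d n) e := by
  classical
  have h := variance_le_sum_revealment_mul_piv (edge := latEdge d n) (latEdge_symm n) (latEdge_ends n)
    (boxBias d n p) (boxBias_nonneg n p.2.1) (boxBias_le_one n p.2.2)
    (separates_sphereSeed hk1 hkn) (R := revMaj n p k) (revMaj_nonneg n p k) (fun e a b hab => by
      obtain ⟨_, he⟩ := latEdge_eq_some_iff.1 hab
      unfold revMaj
      rw [he, Sym2.lift_mk]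
      exact add_le_add (seedProb_sphereSeed_le hd n p k a) (seedProb_sphereSeed_le hd n p k b))
  rwa [sum_wt_garm_eq n p] at h

/-- The cube pivotality term of a pair, weighted by `b_e(1−b_e)`, is `p(1−p)` times Russo's term
`P_p(e ∈ E(ℤ^d), e pivotal)` (both vanish for non-lattice pairs).
[cite: DuminilCopinRaoufiTassion2019, §3 proof of Thm 1.2 (θ_n' = ∑_e Cov(𝟙, ω_e)/(p(1−p)))] -/
theorem bias_mul_pivArm_eq (n : ℕ) (p : unitInterval) (e : PairIdx d n) :
    boxBias d n p e * (1 - boxBias d n p e) * pivArm (latEdge d n) (boxBias d n p) (origin d n) (bdryTarget d n) e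
      = (p : ℝ) * (1 - p) * (bondPercolation (zdGraph d) p).real
          {ω | e.1 ∈ (zdGraph d).edgeSet ∧ IsPivotal (siteToBoundary d n) e.1 ω} := by
  classical
  by_cases he : e.1 ∈ (zdGraph d).edgeSet
  · rw [real_pivotal_eq_pivArm n p e he]
    unfold boxBias; rw [if_pos he]
  · rw [real_pivotal_eq_zero_of_not_mem n p e he]
    unfold boxBias; rw [if_neg he]; ring

/-- **The OSSS one-arm variance inequality on `ℤ^d`** (sum form): for `d ≥ 1`, `n ≥ 0`, `p ∈ [0,1]`,
`n · θ_n(1 − θ_n) ≤ 4 · S_n · p(1−p) · ∑_{e ⊆ Λ_n} P_p(e ∈ E(ℤ^d), e pivotal for {0 ↔ ∂Λ_n})`,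
`θ_k = P_p(0 ↔ ∂Λ_k)`, `S_n = ∑_{k<n} θ_k`.
[cite: DuminilCopinRaoufiTassion2019, §3 Lemma 3.2 and eq. (3.2) (∑_e Cov ≥ n θ_n(1−θ_n)/(8 S_n), q = 1)] -/
theorem oneArm_variance_le (hd : 1 ≤ d) (n : ℕ) (p : unitInterval) :
    (n : ℝ) * ((bondPercolation (zdGraph d) p).real (siteToBoundary d n)
        * (1 - (bondPercolation (zdGraph d) p).real (siteToBoundary d n)))
      ≤ 4 * (∑ j ∈ Finset.range n, (bondPercolation (zdGraph d) p).real (siteToBoundary d j))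
          * ((p : ℝ) * (1 - p))
          * ∑ z ∈ (box d n).sym2, (bondPercolation (zdGraph d) p).real
              {ω | z ∈ (zdGraph d).edgeSet ∧ IsPivotal (siteToBoundary d n) z ω} := by
  classical
  set θ : ℝ := (bondPercolation (zdGraph d) p).real (siteToBoundary d n) with hθ
  set S : ℝ := ∑ j ∈ Finset.range n, (bondPercolation (zdGraph d) p).real (siteToBoundary d j) with hS
  set c : PairIdx d n → ℝ := fun e => boxBias d n p e * (1 - boxBias d n p e)
    * pivArm (latEdge d n) (boxBias d n p) (origin d n) (bdryTarget d n) e with hc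
  have hc0 : ∀ e, 0 ≤ c e := fun e =>
    mul_nonneg (mul_nonneg (boxBias_nonneg n p.2.1 e) (by linarith [boxBias_le_one n p.2.2 e]))
      (pivArm_nonneg (boxBias_nonneg n p.2.1) (boxBias_le_one n p.2.2) _ _ e)
  -- sum the one-sphere inequalities over `k = 1, …, n`
  have hsum : ∑ k ∈ Finset.Icc 1 n, (θ - θ ^ 2) ≤ ∑ k ∈ Finset.Icc 1 n, ∑ e, revMaj n p k e * c e := by
    refine Finset.sum_le_sum fun k hk => ?_
    rw [Finset.mem_Icc] at hk
    have := variance_le_sphere hd n p hk.1 hk.2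
    simpa only [hc, mul_assoc] using this
  rw [Finset.sum_const, Nat.card_Icc, Nat.add_sub_cancel, nsmul_eq_mul, Finset.sum_comm] at hsum
  -- bound the summed revealment by `4 S`
  have hrev : ∑ e, ∑ k ∈ Finset.Icc 1 n, revMaj n p k e * c e ≤ ∑ e, 4 * S * c e := by
    refine Finset.sum_le_sum fun e _ => ?_
    rw [← Finset.sum_mul]
    exact mul_le_mul_of_nonneg_right (sum_revMaj_le n p e) (hc0 e)
  -- identify `∑_e c_e` with `p(1−p)` times Russo's sum
  have hcs : ∑ e, 4 * S * c e = 4 * S * ((p : ℝ) * (1 - p))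
      * ∑ z ∈ (box d n).sym2, (bondPercolation (zdGraph d) p).real
          {ω | z ∈ (zdGraph d).edgeSet ∧ IsPivotal (siteToBoundary d n) z ω} := by
    rw [← Finset.mul_sum]
    simp only [hc, bias_mul_pivArm_eq]
    rw [← Finset.mul_sum, ← Finset.sum_coe_sort (box d n).sym2]
    ring
  have hfin := hsum.trans (hrev.trans (le_of_eq hcs))
  have : (n : ℝ) * (θ * (1 - θ)) = (n : ℝ) * (θ - θ ^ 2) := by ring
  rw [this]
  exact hfin

/-- **The OSSS one-arm differential inequality** (Duminil-Copin–Raoufi–Tassion (3.4) for `q = 1` /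
Duminil-Copin, Lemma 3.8 and Russo's formula): for `d ≥ 1`, `n ≥ 0` and `0 < p < 1`, the function
`θ_n = P_·(0 ↔ ∂Λ_n)` (`DCT16.thetaN d n`) is differentiable at `p` with derivative `D = ∑_e P_p(e pivotal)` and
**`n · θ_n(p)(1 − θ_n(p)) ≤ 4 p(1−p) · S_n(p) · D`**, `S_n(p) = ∑_{k<n} θ_k(p)`.
[cite: DuminilCopinRaoufiTassion2019, §3 proof of Thm 1.2 eqs. (3.2)–(3.4) (θ_n' ≥ c·(n/S_n)·θ_n, case q = 1)] -/
theorem oneArm_hasDerivAt_ge (hd : 1 ≤ d) (n : ℕ) {p : ℝ} (hp : p ∈ Set.Ioo (0 : ℝ) 1) :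
    ∃ D : ℝ, HasDerivAt (thetaN d n) D p ∧ 0 ≤ D ∧
      (n : ℝ) * (thetaN d n p * (1 - thetaN d n p))
        ≤ 4 * (p * (1 - p)) * (∑ k ∈ Finset.range n, thetaN d k p) * D := by
  classical
  have hpI : p ∈ Set.Icc (0 : ℝ) 1 := ⟨hp.1.le, hp.2.le⟩
  have hproj : Set.projIcc 0 1 zero_le_one p = ⟨p, hpI⟩ := Set.projIcc_of_mem _ hpI
  refine ⟨_, russo_formula_sum_holds (zdGraph d) (isUpperSet_siteToBoundary d n) ((box d n).sym2)
    (determinedBy_siteToBoundary d n) p hp, Finset.sum_nonneg fun _ _ => measureReal_nonneg, ?_⟩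
  have h := oneArm_variance_le hd n ⟨p, hpI⟩
  simp only [thetaN, hproj]
  calc (n : ℝ) * ((bondPercolation (zdGraph d) ⟨p, hpI⟩).real (siteToBoundary d n)
        * (1 - (bondPercolation (zdGraph d) ⟨p, hpI⟩).real (siteToBoundary d n)))
      ≤ 4 * (∑ j ∈ Finset.range n, (bondPercolation (zdGraph d) ⟨p, hpI⟩).real (siteToBoundary d j))
          * (p * (1 - p))
          * ∑ z ∈ (box d n).sym2, (bondPercolation (zdGraph d) ⟨p, hpI⟩).real
              {ω | z ∈ (zdGraph d).edgeSet ∧ IsPivotal (siteToBoundary d n) z ω} := h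
    _ = _ := by ring

/-- **The OSSS one-arm differential inequality, `deriv` form**: for `d ≥ 1`, `n ≥ 0`, `0 < p < 1`,
`n · θ_n(p)(1 − θ_n(p)) ≤ 4 p(1−p) · S_n(p) · θ_n'(p)` (Duminil-Copin 2018, display after Lemma 3.8:
"`θ_n' ≥ n/(4p(1−p)S_n) · θ_n(1−θ_n)`"). [cite: DuminilCopinRaoufiTassion2019, §3 proof of Thm 1.2 eq. (3.4) (θ_n' ≥ c·(n/S_n)·θ_n)] -/
theorem oneArm_deriv_ge (hd : 1 ≤ d) (n : ℕ) {p : ℝ} (hp : p ∈ Set.Ioo (0 : ℝ) 1) :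
    (n : ℝ) * (thetaN d n p * (1 - thetaN d n p))
      ≤ 4 * (p * (1 - p)) * (∑ k ∈ Finset.range n, thetaN d k p) * deriv (thetaN d n) p := by
  obtain ⟨D, hD, _, h⟩ := oneArm_hasDerivAt_ge hd n hp
  rwa [hD.deriv]

/-- `θ_n' ≥ 0` on `(0,1)` (Russo: the derivative is a sum of probabilities).
[cite: RussoZW1981, §4 Lemma 3 (4.2) (the derivative is the expected number of pivotal points)] -/
theorem deriv_thetaN_nonneg (hd : 1 ≤ d) (n : ℕ) {p : ℝ} (hp : p ∈ Set.Ioo (0 : ℝ) 1) :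
    0 ≤ deriv (thetaN d n) p := by
  obtain ⟨D, hD, hD0, _⟩ := oneArm_hasDerivAt_ge hd n hp
  rwa [hD.deriv]

/-- `θ_n` is differentiable on `(0,1)` (Russo). [cite: RussoZW1981, §4 Lemma 3 (differentiability of μ_x(A))] -/
theorem differentiableAt_thetaN (n : ℕ) {p : ℝ} (hp : p ∈ Set.Ioo (0 : ℝ) 1) :
    DifferentiableAt ℝ (thetaN d n) p :=
  (russo_formula_sum_holds (zdGraph d) (isUpperSet_siteToBoundary d n) ((box d n).sym2)
    (determinedBy_siteToBoundary d n) p hp).differentiableAt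

end OneArmOSSS

end Literature.Probability.Percolation
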